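import Summits.Ventures.PercRepro.Night2LocalD2R14Col
import Summits.Ventures.PercRepro.Night2LocalD2TwoPair

/-!
# PercRepro — the pair part of an R1₄ column and the far preimages (night-2, gen 15)

* `two_le_card_sdiff_clF_of_mem_pairPre` — a pair preimage has `|G ∖ cl B| ≥ 2`, so `r14PairPre = pairPre`
  (`r14PairPre_eq_pairPre`).
* `mem_opFarPre_iff_mem_pairPre` — the far preimages are exactly the pair preimages with `|G ∖ cl B| = 2`.
* `r14Pair_eq_of_two`, `r14Pair_le_of_three_le` — the pair weights: `7/25` at `m = 2`, at most `2/25` for `m ≥ 3`.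
* **`sum_r14Pair_le`** — `Σ_{pairPre} r14Pair ≤ (7/25)·f + (2/25)·(P' − f)` with `f = #opFarPre S`, `P' = #pairPre S`.
* `r14CovPre_eq_empty_of_two_far`, `r14IdPre_eq_empty_of_two_far`, `r14KeepPre_eq_empty_of_two_far` — two far
  preimages leave no covering preimage of any kind (`coverPreimages_eq_empty_of_card_opFarPre`).
-/

namespace PercRepro.Shadow

open Finset PerFlat ThmH

variable {α : Type*} [DecidableEq α] {M : Matroid α} [M.Finite]

open scoped Classical in
/-- A pair preimage has `|G ∖ cl B| ≥ 2`. -/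
theorem two_le_card_sdiff_clF_of_mem_pairPre {G S B : Finset α} (hB : B ∈ pairPre M 4 G S) :
    2 ≤ (G \ clF M B).card := by
  obtain ⟨-, P, hP, -⟩ := mem_pairPre.1 hB
  rw [Finset.mem_powersetCard] at hP
  have := Finset.card_le_card hP.1
  omega

open scoped Classical in
/-- `r14PairPre = pairPre`. -/
theorem r14PairPre_eq_pairPre (G S : Finset α) : r14PairPre M G S = pairPre M 4 G S := by
  unfold r14PairPre
  apply Finset.filter_true_of_mem
  intro B hB
  have := two_le_card_sdiff_clF_of_mem_pairPre hB
  omega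

open scoped Classical in
/-- The far preimages are the pair preimages with `|G ∖ cl B| = 2`. -/
theorem mem_opFarPre_iff_mem_pairPre {G S B : Finset α} :
    B ∈ opFarPre M G S ↔ B ∈ pairPre M 4 G S ∧ (G \ clF M B).card = 2 := by
  constructor
  · intro hB
    exact ⟨opFarPre_subset_pairPre G S hB, (mem_opFarPre.1 hB).2.1⟩
  · rintro ⟨hB, hm⟩
    obtain ⟨hBm, P, hP, hS⟩ := mem_pairPre.1 hB
    rw [Finset.mem_powersetCard] at hP
    have hPeq : P = G \ clF M B := Finset.eq_of_subset_of_card_le hP.1 (by rw [hP.2, hm])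
    rw [mem_opFarPre]
    exact ⟨hBm, hm, by rw [hS, hPeq]⟩

/-- `r14Pair = 7/25` at `|G ∖ cl B| = 2`. -/
theorem r14Pair_eq_of_two {G B : Finset α} (hm : (G \ clF M B).card = 2) : r14Pair M G B = 7 / 25 := by
  unfold r14Pair
  rw [hm]
  norm_num

/-- `r14Pair ≤ 2/25` for `|G ∖ cl B| ≥ 3`. -/
theorem r14Pair_le_of_three_le {G B : Finset α} (hm : 3 ≤ (G \ clF M B).card) : r14Pair M G B ≤ 2 / 25 := by
  unfold r14Pair
  obtain ⟨m, hmm⟩ : ∃ m, (G \ clF M B).card = m := ⟨_, rfl⟩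
  rw [hmm] at hm ⊢
  by_cases h4 : m ≤ 4
  · simp only [h4, if_true]
    interval_cases m
    · rw [show Nat.choose 3 2 = 3 by decide]; norm_num
    · rw [show Nat.choose 4 2 = 6 by decide]; norm_num
  · simp only [h4, if_false]
    norm_num

open scoped Classical in
/-- **The pair part of a column**: `Σ_{pairPre} r14Pair ≤ (7/25)·f + (2/25)·(P' − f)`. -/
theorem sum_r14Pair_le (G S : Finset α) :
    ∑ B ∈ pairPre M 4 G S, r14Pair M G B ≤
      ((opFarPre M G S).card : ℚ) * (7 / 25) +
        (((pairPre M 4 G S).card : ℚ) - ((opFarPre M G S).card : ℚ)) * (2 / 25) := by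
  have hsplit := Finset.sum_filter_add_sum_filter_not (pairPre M 4 G S) (fun B => (G \ clF M B).card = 2)
    (fun B => r14Pair M G B)
  have hfar : (pairPre M 4 G S).filter (fun B => (G \ clF M B).card = 2) = opFarPre M G S := by
    ext B
    rw [Finset.mem_filter, mem_opFarPre_iff_mem_pairPre]
  have h1 : ∑ B ∈ (pairPre M 4 G S).filter (fun B => (G \ clF M B).card = 2), r14Pair M G B =
      ((opFarPre M G S).card : ℚ) * (7 / 25) := by
    rw [Finset.sum_congr rfl (fun B hB => r14Pair_eq_of_two (Finset.mem_filter.1 hB).2), Finset.sum_const,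
      nsmul_eq_mul, hfar]
  have h2 : ∑ B ∈ (pairPre M 4 G S).filter (fun B => ¬ (G \ clF M B).card = 2), r14Pair M G B ≤
      (((pairPre M 4 G S).filter (fun B => ¬ (G \ clF M B).card = 2)).card : ℚ) * (2 / 25) := by
    rw [← nsmul_eq_mul, ← Finset.sum_const]
    apply Finset.sum_le_sum
    intro B hB
    rw [Finset.mem_filter] at hB
    have := two_le_card_sdiff_clF_of_mem_pairPre hB.1
    exact r14Pair_le_of_three_le (by omega)
  have hcard := Finset.card_filter_add_card_filter_not (s := pairPre M 4 G S)
    (p := fun B => (G \ clF M B).card = 2)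
  rw [hfar] at hcard
  have hcardq : (((pairPre M 4 G S).filter (fun B => ¬ (G \ clF M B).card = 2)).card : ℚ) =
      ((pairPre M 4 G S).card : ℚ) - ((opFarPre M G S).card : ℚ) := by
    have : ((opFarPre M G S).card : ℚ) +
        (((pairPre M 4 G S).filter (fun B => ¬ (G \ clF M B).card = 2)).card : ℚ) =
        ((pairPre M 4 G S).card : ℚ) := by exact_mod_cast hcard
    linarith
  rw [hcardq] at h2
  linarith

open scoped Classical in
/-- Two far preimages leave no covering preimage with `|G ∖ cl B| ≥ 2`. -/
theorem r14CovPre_eq_empty_of_two_far {G : Finset α} (hG : G ∈ flatsQ M (4 + 1)) (hd : (gr M \ G).card = 2)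
    {S : Finset α} (h2 : 2 ≤ (opFarPre M G S).card) : r14CovPre M G S = ∅ := by
  unfold r14CovPre
  rw [coverPreimages_eq_empty_of_card_opFarPre hG hd h2, Finset.filter_empty]

open scoped Classical in
/-- Two far preimages leave no identity preimage. -/
theorem r14IdPre_eq_empty_of_two_far {G : Finset α} (hG : G ∈ flatsQ M (4 + 1)) (hd : (gr M \ G).card = 2)
    {S : Finset α} (h2 : 2 ≤ (opFarPre M G S).card) : r14IdPre M G S = ∅ := by
  unfold r14IdPre
  rw [coverPreimages_eq_empty_of_card_opFarPre hG hd h2, Finset.filter_empty]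

open scoped Classical in
/-- Two far preimages leave no keep preimage. -/
theorem r14KeepPre_eq_empty_of_two_far {G : Finset α} (hG : G ∈ flatsQ M (4 + 1)) (hd : (gr M \ G).card = 2)
    {S : Finset α} (h2 : 2 ≤ (opFarPre M G S).card) : r14KeepPre M G S = ∅ := by
  unfold r14KeepPre
  rw [coverPreimages_eq_empty_of_card_opFarPre hG hd h2, Finset.filter_empty]

end PercRepro.Shadow
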